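import Summits.BirchSwinnertonDyer.BirchSwinnertonDyer.Theorems.CumulativeHeegnerLeopoldtCumulativeHeegnerInclusionAtThreeSpecialisationValues
import HarnessLib

/-!
# Crux K1 `CumulativeHeegnerInclusionAtThree` (stmt-BirchSwinnertonDyer-24198), line `birth`, stub A (= crux 26896):
# the index-currency transfer OFF A FINITE EXCEPTIONAL SET of height-one primes (`Σ_Λ` of Mazur–Rubin Thm. 5.3.10)

Lead seat bsd-line-chl-k1-p1 g5 (`--supports stmt-BirchSwinnertonDyer-24198`). Companion of
`…CumulativeHeegnerInclusionAtThreeSpecialisationValues` (p631301): there `exists_C_pow_mul_mem_span_of_card_quotSMulTop_le` asks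
for the specialised index bound at EVERY distinguished irreducible `Q` prime to `char N`; a Kolyvagin-system argument delivers it only
outside a finite set of height-one primes (Mazur–Rubin, *Kolyvagin systems*, Thm. 5.3.10: «for every height-one prime `𝔓 ∉ Σ_Λ`»;
Howard 2004, proof of Thm. 2.2.10). Here the bound is required only at the `Q` prime to a fixed `a ≠ 0` (take `a` a generator of the
product of the exceptional primes other than `(p)`); the exceptional POINTS are then the zeros of `g₀ · a` in the open disc, still
finitely many, and -w2's algebraic-points domination lemma (p622618) applies unchanged.

* `exists_C_pow_mul_mem_span_of_card_quotSMulTop_le_off` — N f.g. torsion, `char N = (g₀)`, `g₀ ≠ 0`, `a ≠ 0`, `L ∈ R₀⟦T⟧`: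
  «∀ Q dist. irred. prime to g₀ and to a, ∀ root y ∈ ℚ̄_p, ∀ v = L(y): #(N/QN)·‖v‖^{deg Q} ≤ p^{C·deg Q}» ⟹ `∃ μ, p^μ·L ∈ (g₀·R₀⟦T⟧)`.

HONEST FRAMING: pure algebra/analysis; the index bound is a hypothesis (the research content of crux 26896 in the currency a
Kolyvagin-system argument produces); K1 = A + print stays open; BSD is not proved by any of this.
-/

set_option linter.dupNamespace false
set_option autoImplicit false

noncomputable section

open scoped Classical Polynomial
open Literature.NumberTheory.EllipticCurves Literature.NumberTheory.EllipticCurves.IwasawaAlgebra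
  Summit.BirchSwinnertonDyer.Rank1Residual.X11b.Halves
  Summit.BirchSwinnertonDyer.BirchSwinnertonDyer.Theorems.CumulativeHeegnerInclusionAtThreeUnrSeriesDomination
  Summit.BirchSwinnertonDyer.BirchSwinnertonDyer.Theorems.CumulativeHeegnerInclusionAtThreeUnrSeriesZeros
  Summit.BirchSwinnertonDyer.BirchSwinnertonDyer.Theorems.CongruentShaFreeCutBDPUpToPowerMapIdentity
  Summit.BirchSwinnertonDyer.BirchSwinnertonDyer.Theorems.CumulativeHeegnerInclusionAtThreeSpecialisationValues

namespace Summit.BirchSwinnertonDyer.BirchSwinnertonDyer.Theorems.CumulativeHeegnerInclusionAtThreeSpecialisationValuesOff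

variable {p : ℕ} [Fact p.Prime]


/-- **From INDEX currency to stub A's currency, off an exceptional element.** As
`exists_C_pow_mul_mem_span_of_card_quotSMulTop_le`, but the index bound is only required at the distinguished irreducible
`Q` that are prime to a fixed non-zero `a ∈ Λ` (besides `char N`): this is the format of Mazur–Rubin's Thm. 5.3.10 /
Howard's Thm. 2.2.10, whose specialised bounds hold at every height-one prime outside a finite set `Σ_Λ` (take `a` = a
generator of the product of the primes in `Σ_Λ` other than `(p)`). The exceptional points — the zeros of `g₀ · a` in the
open disc — are finitely many, which is all the algebraic-points domination lemma needs. -/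
theorem exists_C_pow_mul_mem_span_of_card_quotSMulTop_le_off (N : Type*) [AddCommGroup N]
    [Module (IwasawaAlgebra p) N] [Module.Finite (IwasawaAlgebra p) N]
    (hN : Module.IsTorsion (IwasawaAlgebra p) N) {g₀ : IwasawaAlgebra p}
    (hg₀ : Module.charIdeal (IwasawaAlgebra p) N = Ideal.span {g₀}) (hg0 : g₀ ≠ 0)
    {a : IwasawaAlgebra p} (ha : a ≠ 0) {L : UnrSeries p} {C : ℕ}
    (hKS : ∀ Q : ℤ_[p][X], Q.IsDistinguishedAt (IsLocalRing.maximalIdeal ℤ_[p]) → Irreducible Q →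
      IsRelPrime g₀ (Q : IwasawaAlgebra p) → IsRelPrime a (Q : IwasawaAlgebra p) →
      ∀ y : PadicAlgCl p, Polynomial.aeval y (Q.map (algebraMap ℤ_[p] ℚ_[p])) = 0 →
      ∀ v : ℂ_[p], L.HasValueAt (y : ℂ_[p]) v →
        (Nat.card (N ⧸ (Ideal.span {(Q : IwasawaAlgebra p)} • ⊤ : Submodule (IwasawaAlgebra p) N)) : ℝ) *
          ‖v‖ ^ Q.natDegree ≤ (p : ℝ) ^ (C * Q.natDegree)) :
    ∃ μ : ℕ, PowerSeries.C (((p : ℕ) : unrIntegers p) ^ μ) * L ∈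
      Ideal.span {PowerSeries.map (toUnr p) g₀} := by
  have hp : p.Prime := Fact.out
  set g : UnrSeries p := PowerSeries.map (toUnr p) g₀ with hgdef
  have hg : g ≠ 0 := map_toUnr_ne_zero hg0
  -- the finitely many zeros of `g · a` in the open disc
  have hga : PowerSeries.map (toUnr p) (g₀ * a) ≠ 0 := map_toUnr_ne_zero (mul_ne_zero hg0 ha)
  have hF : {z : ℂ_[p] | ‖z‖ < 1 ∧ UnrSeries.HasValueAt (PowerSeries.map (toUnr p) (g₀ * a)) z 0}.Finite :=
    finite_zeros hga
  obtain ⟨B, hB, hbd⟩ := exists_card_quotSMulTop_bounds_of_isRelPrime p N hN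
  refine Summit.BirchSwinnertonDyer.BirchSwinnertonDyer.Theorems.CumulativeHeegnerInclusionAtThreeUnrSeriesTadicPin.exists_C_pow_mul_mem_span_of_norm_value_le_algebraic
    hg hF (C := (B : ℝ) * (p : ℝ) ^ C) ?_
  intro y hyF hy1 u v hu hv
  have hy1' : ‖y‖ < 1 := by rwa [PadicComplex.norm_extends] at hy1
  obtain ⟨Q, hQ, hirr, hyQ⟩ := exists_isDistinguishedAt_irreducible_of_norm_lt_one hy1'
  have hd : 0 < Q.natDegree := natDegree_pos_of_irreducible p hQ hirr
  -- the value `w` of `a` at `y`; `u · w ≠ 0` since `y` is not a zero of `g₀ · a`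
  obtain ⟨w, hw⟩ := exists_hasValueAt (PowerSeries.map (toUnr p) a) hy1
  have huw : u * w ≠ 0 := by
    intro h0
    have hmul : UnrSeries.HasValueAt (PowerSeries.map (toUnr p) (g₀ * a)) (y : ℂ_[p]) (u * w) := by
      rw [map_mul]; exact hasValueAt_mul hy1 hu hw
    exact hyF ⟨hy1, h0 ▸ hmul⟩
  have hu0 : u ≠ 0 := left_ne_zero_of_mul huw
  have hw0 : w ≠ 0 := right_ne_zero_of_mul huw
  -- `Q ∤ g₀` and `Q ∤ a`
  have hndvd : ∀ {b : IwasawaAlgebra p} {z : ℂ_[p]},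
      UnrSeries.HasValueAt (PowerSeries.map (toUnr p) b) (y : ℂ_[p]) z → z ≠ 0 →
        IsRelPrime b (Q : IwasawaAlgebra p) := by
    intro b z hz hz0
    refine ((prime_coe_of_irreducible p hQ hirr).irreducible.isRelPrime_iff_not_dvd.mpr ?_).symm
    rintro ⟨k, hk⟩
    have hmem : b - ((0 : ℤ_[p][X]) : IwasawaAlgebra p) ∈ Ideal.span {(Q : IwasawaAlgebra p)} := by
      rw [Polynomial.coe_zero, sub_zero, hk]
      exact Ideal.mul_mem_right _ _ (Ideal.mem_span_singleton_self _)
    have h0 := value_eq_eval_of_sub_mem hQ hyQ hmem hz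
    rw [Polynomial.map_zero, Polynomial.eval_zero] at h0
    exact hz0 h0
  have hcop : IsRelPrime g₀ (Q : IwasawaAlgebra p) := hndvd hu hu0
  have hcopa : IsRelPrime a (Q : IwasawaAlgebra p) := hndvd hw hw0
  -- the three inputs and the combination, as in `…_of_card_quotSMulTop_le`
  have hlink := card_quotient_mul_norm_value_pow_eq_one hQ hirr hcop hyQ hu
  obtain ⟨-, h1, -⟩ := hbd Q hQ g₀ hg₀ hcop
  rw [hg₀] at h1
  have h2 := hKS Q hQ hirr hcop hcopa y hyQ v hv
  set d := Q.natDegree with hddef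
  set c₁ : ℝ := ((Nat.card (IwasawaAlgebra p ⧸ (Ideal.span {(Q : IwasawaAlgebra p)} ⊔ Ideal.span {g₀})) : ℕ) : ℝ)
    with hc₁
  set c₂ : ℝ := ((Nat.card (N ⧸ (Ideal.span {(Q : IwasawaAlgebra p)} • ⊤ : Submodule (IwasawaAlgebra p) N)) : ℕ) : ℝ)
    with hc₂
  have h1' : c₁ ≤ B * c₂ := by rw [hc₁, hc₂]; exact_mod_cast h1
  have hB1 : (1 : ℝ) ≤ B := by exact_mod_cast hB
  have hc₂0 : 0 ≤ c₂ := by rw [hc₂]; exact Nat.cast_nonneg _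
  have hpow : ‖v‖ ^ d ≤ ((B : ℝ) * (p : ℝ) ^ C * ‖u‖) ^ d := by
    calc ‖v‖ ^ d = ‖v‖ ^ d * (c₁ * ‖u‖ ^ d) := by rw [hlink, mul_one]
      _ ≤ ‖v‖ ^ d * (B * c₂ * ‖u‖ ^ d) := by gcongr
      _ = B * (c₂ * ‖v‖ ^ d) * ‖u‖ ^ d := by ring
      _ ≤ B * (p : ℝ) ^ (C * d) * ‖u‖ ^ d := by gcongr
      _ ≤ (B : ℝ) ^ d * ((p : ℝ) ^ C) ^ d * ‖u‖ ^ d := by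
          rw [← pow_mul]
          gcongr
          exact le_self_pow₀ hB1 hd.ne'
      _ = ((B : ℝ) * (p : ℝ) ^ C * ‖u‖) ^ d := by ring
  exact (pow_le_pow_iff_left₀ (norm_nonneg _) (by positivity) hd.ne').mp hpow

end Summit.BirchSwinnertonDyer.BirchSwinnertonDyer.Theorems.CumulativeHeegnerInclusionAtThreeSpecialisationValuesOff

end
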